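import Literature.NumberTheory.LFunctions.BurnolZetaQuotientCompletenessProofs
import Literature.NumberTheory.LFunctions.BurnolResidueExpansionPointwiseProofs
import HarnessLib

/-!
# Burnol 2004b, Thm. 5.2 — the `L²(½+iℝ)` frame: conjunct (2), and conjunct (3) ⇒ conjunct (4)

LINE 1 — LABEL: RH-FREE (`L²` bookkeeping, on the critical line, of the residue expansion of the
transforms of `𝓛₁ ⊂ L_1` over the non-trivial zeros of `ζ` — wherever they are; no hypothesis and no
conclusion about their location). FRAMING (cell rh-crit, D-0074): corpus theorems are RH-FREE literature;
nothing here is worded as progress toward RH. bears_on: B-C/B-P (LADDER-RH COLUMN 6, de Branges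
framework) as corpus structure. WHAT THIS IS NOT: not a route, not a criterion; reductions between the
clauses of an as-printed corpus statement move RH by nothing. Nothing here bears on the truth of RH.

Source. J.-F. Burnol, *Two complete and minimal systems associated with the zeros of the Riemann zeta
function*, JTNB **16** (2004) 65–94 = arXiv:math/0203120v7 [Burnol2004b], Thm. 5.2 (TeX of record
`rh-crit/dbl/src/Burnol2004JTNB_arXivmath0203120v7.tex` l.989–1010; proof of the `L²` half l.1052–1120):
"… It also converges absolutely in `L²`-norm to `G(Z)` on the critical line."  The typed fact
`Burnol2004b_thm5_2` (`BurnolZetaSystemsHardy.lean`) has four conjuncts: (1) pointwise absolute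
convergence to `G(Z)` (dbl-t12, `BurnolResidueExpansionPointwiseProofs.lean`), (2) each partial sum
`S_n(½+iτ)` is square integrable, (3) the Note-5 blocks are summable in `L²(½+iℝ)`-norm, (4)
`‖G − S_n‖_{L²(½+iℝ)} → 0`.

## What is PROVED (theorem-only module: no definition, no new named fact; debt 0)

* `BurnolResidueExpansionL2.memLp_burnolResiduePartialSum_line` — **conjunct (2)**, for every `g ∈ L_1`
  and every height sequence, WITHOUT any mean-square estimate of `ζ`: by the multiplicity bookkeeping
  `BurnolZetaQuotientCompleteness.exists_residueAt_eq_sum` the partial sum `S_n` is, off finitely many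
  points of the line, a finite combination of the transforms `ζ(Z)/(Z−ρ)^l` of the vectors
  `v_{ρ,l} ∈ L_1` of Prop. 4.2, hence (a.e.) the Mellin–Plancherel transform of a vector of `L_1`
  (`exists_mem_span_mellinL2_ae_eq_partialSum`; dbl-t11's `MellinL2.mellinL2`, the boundary-value
  identification `BurnolZetaQuotientCompleteness.mellinL2_resPos_ae_eq`), composed with `ξ = −τ/2π`
  (`Literature.Analysis.Fourier.memLp_comp_mul_left`).
* `BurnolResidueExpansionL2.tendsto_eLpNorm_sub_of_summable` — GENERIC: `f_n ∈ L²`, `Σ‖f_{n+1}−f_n‖₂ < ∞`,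
  `f_n → F` a.e. ⟹ `‖F − f_n‖₂ → 0` (completeness of `L²`; an `L²`-limit is an a.e. limit along a
  subsequence, `tendstoInMeasure_of_tendsto_eLpNorm`).
* `BurnolResidueExpansionL2.tendsto_eLpNorm_line_of_summable` — **(3) ⇒ (4)** for `g ∈ 𝓛₁`: with (1) at
  every non-zero of `ζ` on the line (a.e.: the zeros below any height are finitely many).
* `Burnol2004b_thm5_2_of_summable : (∀ A T, IsInvZetaHeightSeq A T → ∀ g ∈ 𝓛₁, (3)) → Burnol2004b_thm5_2`
  and `Burnol2004b_cor5_3_of_summable : (3) → Burnol2004b_thm4_9 → Burnol2004b_cor5_3` — after this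
  module THE ONE REMAINING INPUT of Thm. 5.2 (hence of Cor. 5.3 / Thm. 3.3 (iii), via
  `BurnolZetaQuotientCompleteness.Burnol2004b_cor5_3_of`) is conjunct (3), the quantitative block estimate
  of the printed proof (rectangles `[−¼, 5/4] × [T_n, T_{n+1}]`, the kernel `(2+s)/((Z−s)(Z+2))`, the
  transfer `Re Z = −½ → ½`; dbl row R27b).

## References
* [Burnol2004b] J.-F. Burnol, JTNB 16 (2004) = arXiv:math/0203120v7, Thm. 5.2 and Note 5
  (pp. 11–13, TeX l.964–1120), Cor. 5.3 (p. 14, TeX l.1124–1127).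
-/

noncomputable section

open MeasureTheory Complex Filter Set
open scoped Real Topology FourierTransform ENNReal

namespace Literature.NumberTheory.LFunctions

namespace BurnolResidueExpansionL2

open Literature.Analysis.Complex Literature.Analysis.FunctionSpaces

/-! ### A. A generic `L²` lemma: summable increments + a.e. limit ⇒ `L²` convergence to that limit -/

/-- **Absolute convergence in `L²` identifies the `L²`-limit with the a.e. limit.** If `f_n ∈ L²`,
`Σ_n ‖f_{n+1} − f_n‖₂ < ∞` and `f_n → F` almost everywhere, then `‖F − f_n‖₂ → 0` (the `f_n` are Cauchy
in the complete space `L²` — Riesz–Fischer —; an `L²`-limit is an a.e. limit along a subsequence,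
Rudin's Thm. 3.12). [cite: Rudin1987, Thm. 3.11 and Thm. 3.12] -/
theorem tendsto_eLpNorm_sub_of_summable {α : Type*} [MeasurableSpace α] {μ : Measure α}
    {f : ℕ → α → ℂ} {F : α → ℂ} (hf : ∀ n, MemLp (f n) 2 μ)
    (hsum : Summable (fun n ↦ (eLpNorm (fun x ↦ f (n + 1) x - f n x) 2 μ).toReal))
    (hlim : ∀ᵐ x ∂μ, Tendsto (fun n ↦ f n x) atTop (𝓝 (F x))) :
    Tendsto (fun n ↦ eLpNorm (fun x ↦ F x - f n x) 2 μ) atTop (𝓝 0) := by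
  set u : ℕ → Lp ℂ 2 μ := fun n ↦ (hf n).toLp (f n) with hu
  -- `u` is Cauchy
  have hdist : ∀ n, dist (u n) (u n.succ) ≤ (eLpNorm (fun x ↦ f (n + 1) x - f n x) 2 μ).toReal := by
    intro n
    rw [Lp.dist_def]
    refine le_of_eq ?_
    congr 1
    rw [eLpNorm_sub_comm]
    refine eLpNorm_congr_ae ?_
    filter_upwards [(hf (n + 1)).coeFn_toLp, (hf n).coeFn_toLp] with x h1 h2
    rw [Pi.sub_apply, Nat.succ_eq_add_one, h1, h2]
  have hcs : CauchySeq u := cauchySeq_of_dist_le_of_summable _ hdist hsum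
  obtain ⟨L, hL⟩ := cauchySeq_tendsto_of_complete hcs
  -- `L²` convergence of the representatives, then a.e. along a subsequence
  have hL2 : Tendsto (fun n ↦ eLpNorm (⇑(u n) - ⇑L) 2 μ) atTop (𝓝 0) :=
    (Lp.tendsto_Lp_iff_tendsto_eLpNorm' u L).1 hL
  have hIn := tendstoInMeasure_of_tendsto_eLpNorm two_ne_zero
    (fun n ↦ (Lp.aestronglyMeasurable (u n))) (Lp.aestronglyMeasurable L) hL2
  obtain ⟨ns, hns, hae⟩ := hIn.exists_seq_tendsto_ae
  have hcoe : ∀ᵐ x ∂μ, ∀ n, (u n : α → ℂ) x = f n x := ae_all_iff.2 fun n ↦ (hf n).coeFn_toLp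
  have hLF : (L : α → ℂ) =ᵐ[μ] F := by
    filter_upwards [hae, hcoe, hlim] with x h1 h2 h3
    have h1' : Tendsto (fun i ↦ f (ns i) x) atTop (𝓝 ((L : α → ℂ) x)) := by
      refine h1.congr fun i ↦ ?_
      rw [h2]
    exact tendsto_nhds_unique h1' (h3.comp hns.tendsto_atTop)
  refine hL2.congr fun n ↦ ?_
  rw [eLpNorm_sub_comm]
  refine eLpNorm_congr_ae ?_
  filter_upwards [hLF, (hf n).coeFn_toLp] with x h1 h2
  rw [Pi.sub_apply, h1, h2]

/-! ### B. Conjunct (2): the partial sums are square integrable on the critical line -/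

/-- The non-trivial zeros below height `T` form a finite set. [folklore] -/
private theorem ntz_below_finite (T : ℝ) :
    {ρ : ℂ | ρ ∈ ZetaZeros.riemannZetaNontrivialZeros ∧ |ρ.im| < T}.Finite := by
  refine (((isCompact_Icc (a := (0 : ℝ)) (b := 1)).reProdIm
    (isCompact_Icc (a := -T) (b := T))).inter_riemannZetaZeros_finite).subset ?_
  rintro ρ ⟨hρ, hT⟩
  have h := mem_riemannZetaNontrivialZeros_iff_holds.1 hρ
  exact ⟨Complex.mem_reProdIm.2 ⟨⟨h.2.1.le, h.2.2.le⟩, abs_lt.1 hT |>.imp le_of_lt le_of_lt⟩, h.1⟩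

/-- A non-trivial zero is not `1`. [folklore] -/
private theorem ne_one_of_mem_ntz {ρ : ℂ} (hρ : ρ ∈ ZetaZeros.riemannZetaNontrivialZeros) : ρ ≠ 1 := by
  intro h
  have := (mem_riemannZetaNontrivialZeros_iff_holds.1 hρ).2.2
  rw [h, one_re] at this
  exact lt_irrefl _ this

/-- For `ρ ≠ 1`, `k < (m_ρ).toNat` is an admissible index. [folklore] -/
private theorem index_lt {ρ : ℂ} (hρ1 : ρ ≠ 1) {k : ℕ} (hk : k < (riemannZetaZeroOrder ρ).toNat) :
    (k : ℤ) < riemannZetaZeroOrder ρ := by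
  have h0 := riemannZetaZeroOrder_nonneg hρ1
  have : ((riemannZetaZeroOrder ρ).toNat : ℤ) = riemannZetaZeroOrder ρ := Int.toNat_of_nonneg h0
  omega

/-- The representative of a finite sum of `L²` classes is a.e. the sum of the representatives. [folklore] -/
private theorem coeFn_finset_sum {α : Type*} [MeasurableSpace α] {μ : Measure α} {ι : Type*}
    (t : Finset ι) (F : ι → Lp ℂ 2 μ) :
    ((∑ i ∈ t, F i : Lp ℂ 2 μ) : α → ℂ) =ᵐ[μ] fun x ↦ ∑ i ∈ t, (F i : α → ℂ) x := by
  classical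
  induction t using Finset.induction_on with
  | empty =>
    simp only [Finset.sum_empty]
    exact Lp.coeFn_zero ℂ 2 μ
  | insert i t hi ih =>
    rw [Finset.sum_insert hi]
    filter_upwards [Lp.coeFn_add (F i) (∑ j ∈ t, F j), ih] with x hx hx'
    rw [hx, Pi.add_apply, hx', Finset.sum_insert hi]

/-- **The `n`-th partial sum of the residue expansion IS, on the critical line, the Mellin–Plancherel
transform of a vector of `span{v_{ρ,l}} ⊂ L_1`** (in the `ξ`-parametrisation `Z = ½ − 2πiξ`): for
`g ∈ L_1` there is `V ∈ span (range zetaQuotientSystem)` with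
`𝓜(V|_{(0,∞)})(ξ) = S_n(½ − 2πiξ)` a.e. (Note 5's bookkeeping `exists_residueAt_eq_sum`).
[cite: Burnol2004b, Thm. 5.2 and Note 5 (arXiv:math/0203120v7 p. 12, TeX l.1004–1010)] -/
theorem exists_mem_span_mellinL2_ae_eq_partialSum {g : Lp ℂ 2 (volume : Measure ℝ)}
    (hg : g ∈ sonineL 1) (T : ℕ → ℝ) (n : ℕ) :
    ∃ V ∈ Submodule.span ℂ (Set.range zetaQuotientSystem),
      (MellinL2.mellinL2 (LpToLpRestrictCLM ℝ ℂ ℂ (volume : Measure ℝ) 2 (Ioi (0 : ℝ)) V) : ℝ → ℂ)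
        =ᵐ[volume] fun ξ : ℝ ↦
          burnolResiduePartialSum (rightMellinExt g) T n (1 - (1 / 2 + 2 * π * ξ * I)) := by
  set G : ℂ → ℂ := rightMellinExt g with hGdef
  have hcont := hasRightMellinContinuation_rightMellinExt_of_mem_sonineL one_pos hg
  have hb : ∀ ρ : ℂ, ∃ b : ℕ → ℂ, ρ ∈ ZetaZeros.riemannZetaNontrivialZeros → ∀ Z : ℂ, Z ≠ ρ →
      residueAt (fun s ↦ G s / riemannZeta s * (riemannZeta Z / (Z - s))) ρ =
        ∑ k ∈ Finset.range (riemannZetaZeroOrder ρ).toNat, b k * (riemannZeta Z / (Z - ρ) ^ (k + 1)) := by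
    intro ρ
    by_cases hρ : ρ ∈ ZetaZeros.riemannZetaNontrivialZeros
    · have hGa : AnalyticAt ℂ G ρ := hcont.1.analyticAt (isOpen_ne.mem_nhds (ne_one_of_mem_ntz hρ))
      obtain ⟨b, hb⟩ := BurnolZetaQuotientCompleteness.exists_residueAt_eq_sum hρ hGa
      exact ⟨b, fun _ ↦ hb⟩
    · exact ⟨fun _ ↦ 0, fun h ↦ absurd h hρ⟩
  choose b hb using hb
  set F : Finset ℂ := (ntz_below_finite (T n)).toFinset with hFdef
  have hF : ∀ ρ, ρ ∈ F ↔ ρ ∈ ZetaZeros.riemannZetaNontrivialZeros ∧ |ρ.im| < T n := fun ρ ↦ by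
    simp [hFdef]
  set V : Lp ℂ 2 (volume : Measure ℝ) := ∑ ρ ∈ F,
    ∑ k ∈ Finset.range (riemannZetaZeroOrder ρ).toNat, b ρ k • zetaQuotientVector ρ (k + 1) with hVdef
  refine ⟨V, ?_, ?_⟩
  · refine Submodule.sum_mem _ fun ρ hρ ↦ Submodule.sum_mem _ fun k hk ↦ Submodule.smul_mem _ _ ?_
    exact Submodule.subset_span ⟨⟨(ρ, k), ((hF ρ).1 hρ).1,
      index_lt (ne_one_of_mem_ntz ((hF ρ).1 hρ).1) (Finset.mem_range.1 hk)⟩, rfl⟩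
  -- the partial sum off the zeros involved
  have hSΦ : ∀ Z, (∀ ρ ∈ F, Z ≠ ρ) → burnolResiduePartialSum G T n Z =
      ∑ ρ ∈ F, ∑ k ∈ Finset.range (riemannZetaZeroOrder ρ).toNat, b ρ k * zetaOverPow ρ (k + 1) Z := by
    intro Z hZ
    rw [burnolResiduePartialSum, finsum_mem_eq_finite_toFinset_sum _ (ntz_below_finite (T n))]
    refine Finset.sum_congr rfl fun ρ hρ ↦ ?_
    rw [hb ρ ((hF ρ).1 hρ).1 Z (hZ ρ hρ)]
    refine Finset.sum_congr rfl fun k _ ↦ ?_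
    rw [BurnolZetaHardy.zetaOverPow_of_ne (hZ ρ hρ)]
  -- the transforms of the vectors
  have hMv : ∀ ρ ∈ ZetaZeros.riemannZetaNontrivialZeros, ∀ k, k < (riemannZetaZeroOrder ρ).toNat →
      (MellinL2.mellinL2 (LpToLpRestrictCLM ℝ ℂ ℂ (volume : Measure ℝ) 2 (Ioi (0 : ℝ))
        (zetaQuotientVector ρ (k + 1))) : ℝ → ℂ) =ᵐ[volume]
        fun ξ : ℝ ↦ zetaOverPow ρ (k + 1) (1 - (1 / 2 + 2 * π * ξ * I)) := by
    intro ρ hρ k hk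
    have hlm : ((k + 1 : ℕ) : ℤ) ≤ riemannZetaZeroOrder ρ := by
      have := index_lt (ne_one_of_mem_ntz hρ) hk
      push_cast; omega
    have hv := BurnolZetaDuality.isZetaQuotientVector_zetaQuotientVector hρ (l := k + 1) (by omega) hlm
    filter_upwards [BurnolZetaQuotientCompleteness.mellinL2_resPos_ae_eq hv.1] with ξ hξ
    rw [hξ]
    refine BurnolZetaDuality.rightMellinExt_zetaQuotientVector hρ (by omega) hlm ?_
    intro h
    have := congrArg Complex.re h
    simp at this
  have hnull : ∀ᵐ ξ : ℝ, ∀ ρ ∈ F, (1 : ℂ) - (1 / 2 + 2 * π * ξ * I) ≠ ρ := by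
    have hfin : ((fun ρ : ℂ ↦ -ρ.im / (2 * π)) '' (F : Set ℂ)).Finite := F.finite_toSet.image _
    have hz : volume ((fun ρ : ℂ ↦ -ρ.im / (2 * π)) '' (F : Set ℂ)) = 0 := hfin.measure_zero volume
    filter_upwards [measure_eq_zero_iff_ae_notMem.1 hz] with ξ hξ ρ hρ h
    apply hξ
    refine ⟨ρ, hρ, ?_⟩
    have := congrArg Complex.im h
    simp at this
    field_simp
    linarith
  rw [hVdef]
  simp only [map_sum, map_smul]
  have hall : ∀ᵐ ξ : ℝ, ∀ ρ ∈ F, ∀ k ∈ Finset.range (riemannZetaZeroOrder ρ).toNat,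
      ((b ρ k • MellinL2.mellinL2 (LpToLpRestrictCLM ℝ ℂ ℂ (volume : Measure ℝ) 2 (Ioi (0 : ℝ))
        (zetaQuotientVector ρ (k + 1))) : Lp ℂ 2 (volume : Measure ℝ)) : ℝ → ℂ) ξ =
        b ρ k * zetaOverPow ρ (k + 1) (1 - (1 / 2 + 2 * π * ξ * I)) := by
    refine F.eventually_all.2 fun ρ hρ ↦ (Finset.range _).eventually_all.2 fun k hk ↦ ?_
    filter_upwards [hMv ρ ((hF ρ).1 hρ).1 k (Finset.mem_range.1 hk),
      Lp.coeFn_smul (b ρ k) (MellinL2.mellinL2 (LpToLpRestrictCLM ℝ ℂ ℂ (volume : Measure ℝ) 2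
        (Ioi (0 : ℝ)) (zetaQuotientVector ρ (k + 1))))] with ξ h1 h2
    rw [h2, Pi.smul_apply, h1, smul_eq_mul]
  filter_upwards [hall, coeFn_finset_sum F fun ρ ↦ ∑ k ∈ Finset.range (riemannZetaZeroOrder ρ).toNat,
      b ρ k • MellinL2.mellinL2 (LpToLpRestrictCLM ℝ ℂ ℂ (volume : Measure ℝ) 2 (Ioi (0 : ℝ))
        (zetaQuotientVector ρ (k + 1))),
    F.eventually_all.2 fun ρ _ ↦ coeFn_finset_sum (Finset.range (riemannZetaZeroOrder ρ).toNat)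
      fun k ↦ b ρ k • MellinL2.mellinL2 (LpToLpRestrictCLM ℝ ℂ ℂ (volume : Measure ℝ) 2 (Ioi (0 : ℝ))
        (zetaQuotientVector ρ (k + 1))), hnull] with ξ h1 h2 h3 h4
  rw [h2, hSΦ _ h4]
  refine Finset.sum_congr rfl fun ρ hρ ↦ ?_
  rw [h3 ρ hρ]
  exact Finset.sum_congr rfl fun k hk ↦ h1 ρ hρ k hk

/-- **Conjunct (2) of Thm. 5.2: the partial sums `S_n(½+iτ)` are square integrable in `τ`** — for every
`g ∈ L_1` (not only `𝓛₁`) and every height sequence: `S_n` restricted to the critical line is (a.e.) the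
Mellin–Plancherel transform of a vector of `L_1`, composed with `ξ = −τ/2π`. No mean-square estimate of
`ζ` is used. [cite: Burnol2004b, Thm. 5.2 (arXiv:math/0203120v7 p. 12, TeX l.989–1010, 1052–1058)] -/
theorem memLp_burnolResiduePartialSum_line {g : Lp ℂ 2 (volume : Measure ℝ)} (hg : g ∈ sonineL 1)
    (T : ℕ → ℝ) (n : ℕ) :
    MemLp (fun τ : ℝ ↦ burnolResiduePartialSum (rightMellinExt g) T n (1 / 2 + τ * I)) 2 volume := by
  obtain ⟨V, -, hV⟩ := exists_mem_span_mellinL2_ae_eq_partialSum hg T n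
  have hΨ : MemLp (fun ξ : ℝ ↦
      burnolResiduePartialSum (rightMellinExt g) T n (1 - (1 / 2 + 2 * π * ξ * I))) 2 volume :=
    (Lp.memLp _).ae_eq hV
  have hc : (-(2 * π))⁻¹ ≠ (0 : ℝ) := inv_ne_zero (neg_ne_zero.2 (by positivity))
  have h := Literature.Analysis.Fourier.memLp_comp_mul_left hΨ hc
  refine h.ae_eq (Eventually.of_forall fun τ ↦ ?_)
  simp only
  congr 1
  have hπ : (π : ℂ) ≠ 0 := ofReal_ne_zero.2 Real.pi_ne_zero
  push_cast
  field_simp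
  ring

/-! ### C. (3) ⇒ (4), and Thm. 5.2 from its summability clause -/

/-- Almost every point of the critical line is not a zero of `ζ` (the zeros below any height are
finitely many). [folklore] -/
private theorem ae_zeta_line_ne_zero : ∀ᵐ τ : ℝ, riemannZeta (1 / 2 + τ * I) ≠ 0 := by
  set E : Set ℝ := {τ : ℝ | riemannZeta (1 / 2 + τ * I) = 0} with hE
  have hsub : E ⊆ ⋃ n : ℕ, (fun ρ : ℂ ↦ ρ.im) ''
      {ρ : ℂ | ρ ∈ ZetaZeros.riemannZetaNontrivialZeros ∧ |ρ.im| < (n : ℝ)} := by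
    intro τ hτ
    obtain ⟨n, hn⟩ := exists_nat_gt |τ|
    refine mem_iUnion.2 ⟨n, ⟨1 / 2 + τ * I, ⟨⟨?_, ?_⟩, ?_⟩, by simp⟩⟩
    · exact hτ
    · rintro ⟨m, hm⟩
      have := congrArg Complex.re hm
      simp at this
      linarith
    · simpa using hn
  have hcount : (⋃ n : ℕ, (fun ρ : ℂ ↦ ρ.im) ''
      {ρ : ℂ | ρ ∈ ZetaZeros.riemannZetaNontrivialZeros ∧ |ρ.im| < (n : ℝ)}).Countable :=
    Set.countable_iUnion fun n ↦ ((ntz_below_finite n).image _).countable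
  have hz : volume E = 0 := measure_mono_null hsub (hcount.measure_zero volume)
  filter_upwards [measure_eq_zero_iff_ae_notMem.1 hz] with τ hτ
  exact hτ

/-- **Conjunct (4) from conjuncts (1)–(3)**: for `g ∈ 𝓛₁` and a height sequence of Prop. 5.1, IF the
blocks of the residue expansion are summable in `L²(½+iℝ)`-norm (conjunct (3), "converges absolutely in
`L²`-norm"), then `S_n → G_g` in `L²(½+iℝ)` — the `L²`-limit exists by completeness and is identified
with `G_g` by the pointwise conjunct (dbl-t12's `BurnolResidueSum.tendsto_burnolResiduePartialSum`, valid
at every point of the line that is not a zero of `ζ`, i.e. almost everywhere).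
[cite: Burnol2004b, Thm. 5.2 (arXiv:math/0203120v7 p. 12, TeX l.989–1010, 1052–1120)] -/
theorem tendsto_eLpNorm_line_of_summable {A : ℝ} {T : ℕ → ℝ} (hT : IsInvZetaHeightSeq A T)
    {g : Lp ℂ 2 (volume : Measure ℝ)} (hg : g ∈ burnolScriptL1)
    (h3 : Summable (fun n : ℕ ↦ (eLpNorm (fun τ : ℝ ↦
        burnolResiduePartialSum (rightMellinExt g) T (n + 1) (1 / 2 + τ * I) -
          burnolResiduePartialSum (rightMellinExt g) T n (1 / 2 + τ * I)) 2 volume).toReal)) :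
    Tendsto (fun n : ℕ ↦ eLpNorm (fun τ : ℝ ↦ rightMellinExt g (1 / 2 + τ * I) -
        burnolResiduePartialSum (rightMellinExt g) T n (1 / 2 + τ * I)) 2 volume) atTop (𝓝 0) := by
  have hae : ∀ᵐ τ : ℝ, Tendsto (fun n : ℕ ↦ burnolResiduePartialSum (rightMellinExt g) T n (1 / 2 + τ * I))
      atTop (𝓝 (rightMellinExt g (1 / 2 + τ * I))) := by
    filter_upwards [ae_zeta_line_ne_zero] with τ hτ
    refine (BurnolResidueSum.tendsto_burnolResiduePartialSum hT hg (Z := 1 / 2 + τ * I) ?_ hτ).2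
    intro h
    have := congrArg Complex.re h
    simp at this
  have hmem : ∀ n : ℕ, MemLp (fun τ : ℝ ↦ burnolResiduePartialSum (rightMellinExt g) T n (1 / 2 + τ * I))
      2 volume := fun n ↦ memLp_burnolResiduePartialSum_line hg.1 T n
  have h := @tendsto_eLpNorm_sub_of_summable ℝ _ volume
    (fun n τ ↦ burnolResiduePartialSum (rightMellinExt g) T n (1 / 2 + τ * I))
    (fun τ ↦ rightMellinExt g (1 / 2 + τ * I)) hmem h3 hae
  exact h

end BurnolResidueExpansionL2

open BurnolResidueExpansionL2 in
/-- **Burnol 2004b, Thm. 5.2, reduced to its `L²`-summability clause.** GIVEN conjunct (3) of the typed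
fact — for every height sequence of Prop. 5.1 and every `g ∈ 𝓛₁`, the Note-5 blocks of the residue
expansion are summable in `L²(½+iℝ)`-norm (the printed "converges absolutely in `L²`-norm", TeX
l.1052–1120, whose proof runs through rectangles `[−¼,5/4] × [T_n,T_{n+1}]` and the transfer
`Re Z = −½ → ½`) — the whole fact `Burnol2004b_thm5_2` holds: conjunct (1) is dbl-t12's
`BurnolResidueSum.tendsto_burnolResiduePartialSum`, conjunct (2) is `memLp_burnolResiduePartialSum_line`
(Mellin–Plancherel), conjunct (4) is `tendsto_eLpNorm_line_of_summable`.
[cite: Burnol2004b, Thm. 5.2 (arXiv:math/0203120v7 p. 12, TeX l.989–1120)] -/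
theorem Burnol2004b_thm5_2_of_summable
    (h3 : ∀ A : ℝ, ∀ T : ℕ → ℝ, IsInvZetaHeightSeq A T → ∀ g ∈ burnolScriptL1,
      Summable (fun n : ℕ ↦ (eLpNorm (fun τ : ℝ ↦
        burnolResiduePartialSum (rightMellinExt g) T (n + 1) (1 / 2 + τ * I) -
          burnolResiduePartialSum (rightMellinExt g) T n (1 / 2 + τ * I)) 2 volume).toReal)) :
    Burnol2004b_thm5_2 := by
  intro A T hT g hg
  exact ⟨fun Z hZ1 hZ0 ↦ BurnolResidueSum.tendsto_burnolResiduePartialSum hT hg hZ1 hZ0,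
    fun n ↦ memLp_burnolResiduePartialSum_line hg.1 T n, h3 A T hT g hg,
    tendsto_eLpNorm_line_of_summable hT hg (h3 A T hT g hg)⟩

/-- **Cor. 5.3 and Thm. 3.3 reduced to the same clause** (with Thm. 4.9, `Burnol2004b_thm4_9`, filed by
dbl-t1): the chain `(3) ⇒ Thm. 5.2 ⇒ Cor. 5.3` (`Burnol2004b_cor5_3_of`).
[cite: Burnol2004b, Cor. 5.3 (arXiv:math/0203120v7 p. 14, TeX l.1124–1127)] -/
theorem Burnol2004b_cor5_3_of_summable
    (h3 : ∀ A : ℝ, ∀ T : ℕ → ℝ, IsInvZetaHeightSeq A T → ∀ g ∈ burnolScriptL1,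
      Summable (fun n : ℕ ↦ (eLpNorm (fun τ : ℝ ↦
        burnolResiduePartialSum (rightMellinExt g) T (n + 1) (1 / 2 + τ * I) -
          burnolResiduePartialSum (rightMellinExt g) T n (1 / 2 + τ * I)) 2 volume).toReal))
    (h49 : Burnol2004b_thm4_9) : Burnol2004b_cor5_3 :=
  BurnolZetaQuotientCompleteness.Burnol2004b_cor5_3_of (Burnol2004b_thm5_2_of_summable h3) h49

end Literature.NumberTheory.LFunctions

end
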